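import Mathlib
import HarnessLib
import Summits.HubbardSuperconductivity.HubbardSuperconductivity.Theorems.KLProgrammeKLRegimeBetaSplitEdgeW
import Summits.HubbardSuperconductivity.HubbardSuperconductivity.Theorems.KLProgrammeKLRegimeBetaSplitV9S
import Summits.HubbardSuperconductivity.HubbardSuperconductivity.Theorems.KLProgrammeKLRegimeSplitEdgeMassProfile

/-!
# Route `KLProgramme` — crux K3 (stmt-HubbardSuperconductivity-19937), CHILD 1 at SLOT level on the WICK carriers:
# `BetaSplitP Pr W` for EVERY bundle with split ⇐ `BetaSplitAtW` and engine ⇒ `EngineBoundsAtW9S` — `betaSplitP_of_slotsW9S`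

Cell gate-hubbard-kl, seat hubbard-kl-k3c1-p2 (g6; child-1 re-closure lineage).  Twin of k3c1-p1 g4's `betaSplitP_of_slotsV9S`
(`…KLRegimeBetaSplitV9S`) — proof adapted from that file, token for token — for the Wick-carrier slots of p1 g8's `…KLRegimeSplitEngineV9` §2
(E2-STRUCTURE option (B)): the extra family `𝔛 j Qm k k′ := thermalBar + legDressBarQ·countT + (Klam U)²·(max (phGain j |k−k′|_𝕋) 0 + max (phGain j
|k+k′−Qm|_𝕋) 0)` at `1 ≤ j` (`legDressBarQ … 0 4` at `j = 0`), numerals `(sG, sQ, tG, tQ, tN) = (3, 8, 10/3, 48, 15)`, sign-defect allowance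
`2·klEdge G j |Qm|_𝕋` (`sum_min_one_edge_le`), the four `𝔛`-facts by k3c1-p1's `klbs9_*`, closed through `betaSplitP_of_edgeClausesW`
(`…KLRegimeBetaSplitEdgeW`).  The bundle one-liner `betaSplitP_klPredsW14 W := betaSplitP_of_slotsW9S (Pr := klPredsW14) (fun … h => h) (fun … h => h)`
follows the Wick bundle.  Everything is proved; nothing about the model is asserted.
-/

noncomputable section

namespace Summit.HubbardSuperconductivity.HubbardSuperconductivity.Theorems.KLRegimeSplit

set_option linter.dupNamespace false -- summit = problem name (single-conjunct summit), D-0017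

open Real Finset Literature.MathematicalPhysics.QuantumLattice Literature.Probability.LatticeModels
open Summit.HubbardSuperconductivity.HubbardSuperconductivity.Theorems.KLProgrammeLegKernels
open Summit.HubbardSuperconductivity.HubbardSuperconductivity.Theorems.CooperChannelRiccatiFlow
open Summit.HubbardSuperconductivity.HubbardSuperconductivity.Theorems.DispersionFlow


/-- **Child 1 at slot level on the WICK carriers, every bundle and window.**  If `BetaSplitAtW ⇒ Pr.split` and `Pr.engine ⇒ EngineBoundsAtW9S`
((E2-W9) = (E2-v9) on `klWickPairAmplitude`/`klWickPairArray`), then `BetaSplitP Pr W`.  Proof = `betaSplitP_of_slotsV9S` (k3c1-p1 g4) token for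
token through `betaSplitP_of_edgeClausesW`: the same extra family (thermal + leg dressing + crossed-channel gains (X), `max … 0`-guarded), numerals
`(sG, sQ, tG, tQ, tN) = (3, 8, 10/3, 48, 15)`, sign-defect allowance `2·klEdge`. -/
theorem betaSplitP_of_slotsW9S {Pr : Preds} {W : Set ℝ}
    (hs : ∀ (L M : ℕ) [NeZero L] [NeZero M] (G : GeoConsts) (P : SplitConsts) (Q : EngConsts) (β U μ : ℝ) (K : TrigPolyC4v) (n : ℕ),
      BetaSplitAtW L M G P Q β U μ K n → Pr.split L M G P Q β U μ K n)
    (he : ∀ (L M : ℕ) [NeZero L] [NeZero M] (G : GeoConsts) (P : SplitConsts) (Q : EngConsts) (β U μ : ℝ) (K : TrigPolyC4v) (n : ℕ),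
      Pr.engine L M G P Q β U μ K n → EngineBoundsAtW9S L M G P Q β U μ K n) :
    BetaSplitP Pr W := by
  refine betaSplitP_of_edgeClausesW (Pr := Pr) (sG := 3) (sQ := 8) (tG := 10 / 3) (tQ := 48) (tN := 15) (by norm_num) (by norm_num)
    (by norm_num) (by norm_num) (by norm_num) (by unfold klLegKappa; norm_num)
    (fun L G P Q β U μ K j Qm k k' =>
      if 1 ≤ j then thermalBar G P U β j + legDressBarQ G P Q U j (legSliceCountT L β μ K j ![k', Qm - k', Qm - k, k]) +
        (P.Klam * U) ^ 2 * (max (G.phGain j (klTorusNorm L (k - k'))) 0 + max (G.phGain j (klTorusNorm L (k + k' - Qm))) 0)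
      else legDressBarQ G P Q U 0 4)
    ?_ ?_ ?_ ?_ (fun L G P Q β U μ K j Qm => 2 * klEdge G j (klTorusNorm L Qm)) ?_ hs ?_
  · -- nonnegativity
    intro L G P Q β U μ K j Qm k k' hG hP hQ
    have hCF : 0 ≤ G.CF := hG.2.2.2.2.2.2.2.2.2.2.2.2.2.1
    have hK0 : 0 ≤ P.Klam := zero_le_one.trans hP.1
    split_ifs
    · exact add_nonneg (add_nonneg (thermalBar_nonneg hCF P U β j) (legDressBarQ_nonneg G hK0 hQ.2.1 U j _))
        (klbs9_X_nonneg G P U j _ _)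
    · exact legDressBarQ_nonneg G hK0 hQ.2.1 U 0 _
  · -- per-scale size (`≤ 3·CF(Klam U)² + 8·CR·Klam³·U²`)
    intro L G P Q β U μ K j Qm k k' hG hP hQ hU hU1
    have hCF : 0 ≤ G.CF := hG.2.2.2.2.2.2.2.2.2.2.2.2.2.1
    have hK0 : 0 ≤ P.Klam := zero_le_one.trans hP.1
    have hCR : 0 ≤ Q.CR := hQ.2.1
    have hcr3 := cr3_le hP.1 hCR hU1
    have hq30 : 0 ≤ Q.CR * P.Klam ^ 3 * U ^ 2 := by positivity
    have hg20 : 0 ≤ G.CF * (P.Klam * U) ^ 2 := by positivity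
    split_ifs with hj
    · have h1 := thermalBar_le hCF P U β j
      have h2 := legDressBarQ_le G hK0 hCR U j (legSliceCountT L β μ K j ![k', Qm - k', Qm - k, k])
      have h4 : (legSliceCountT L β μ K j ![k', Qm - k', Qm - k, k] : ℝ) ≤ 4 := by
        exact_mod_cast legSliceCountT_le_four L β μ K j _
      have h3 : Q.CR * ((P.Klam * U) ^ 2 + (P.Klam * |U|) ^ 3) * (legSliceCountT L β μ K j ![k', Qm - k', Qm - k, k] : ℝ) ≤
          2 * Q.CR * P.Klam ^ 3 * U ^ 2 * 4 := mul_le_mul hcr3 h4 (Nat.cast_nonneg _) (by positivity)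
      have h5 : (P.Klam * U) ^ 2 * (max (G.phGain j (klTorusNorm L (k - k'))) 0 + max (G.phGain j (klTorusNorm L (k + k' - Qm))) 0) ≤
          2 * (G.CF * (P.Klam * U) ^ 2) := klbs9_X_le hG P U j (torusSupNorm_nonneg _) (torusSupNorm_nonneg _)
      linarith
    · have h2 := legDressBarQ_le G hK0 hCR U 0 4
      have h3 : Q.CR * ((P.Klam * U) ^ 2 + (P.Klam * |U|) ^ 3) * ((4 : ℕ) : ℝ) ≤ 2 * Q.CR * P.Klam ^ 3 * U ^ 2 * 4 := by
        rw [Nat.cast_ofNat]; nlinarith [hcr3]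
      linarith
  · -- scale sums over `(t, n]`
    intro L G P Q β U μ K t n Qm k k' hG hP hQ hU hU1 hn
    have hCF : 0 ≤ G.CF := hG.2.2.2.2.2.2.2.2.2.2.2.2.2.1
    have hK0 : 0 ≤ P.Klam := zero_le_one.trans hP.1
    have hcr3 := cr3_le hP.1 hQ.2.1 hU1
    have hq30 : 0 ≤ Q.CR * P.Klam ^ 3 * U ^ 2 := by have := hQ.2.1; positivity
    have heq : ∀ j ∈ Ioc t n, (if 1 ≤ j then thermalBar G P U β j +
        legDressBarQ G P Q U j (legSliceCountT L β μ K j ![k', Qm - k', Qm - k, k]) +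
        (P.Klam * U) ^ 2 * (max (G.phGain j (klTorusNorm L (k - k'))) 0 + max (G.phGain j (klTorusNorm L (k + k' - Qm))) 0)
        else legDressBarQ G P Q U 0 4) =
        thermalBar G P U β j + legDressBarQ G P Q U j (legSliceCountT L β μ K j ![k', Qm - k', Qm - k, k]) +
        (P.Klam * U) ^ 2 * (max (G.phGain j (klTorusNorm L (k - k'))) 0 + max (G.phGain j (klTorusNorm L (k + k' - Qm))) 0) := by
      intro j hj
      simp only [mem_Ioc] at hj
      rw [if_pos (by omega)]
    rw [sum_congr rfl heq, sum_add_distrib, sum_add_distrib]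
    have hsub : ∀ (f : ℕ → ℝ), (∀ j, 0 ≤ f j) → ∑ j ∈ Ioc t n, f j ≤ ∑ j ∈ range (n + 1), f j := fun f hf =>
      sum_le_sum_of_subset_of_nonneg (fun j hj => by simp only [mem_Ioc] at hj; exact mem_range.2 (by omega)) fun j _ _ => hf j
    have h1 : ∑ j ∈ Ioc t n, thermalBar G P U β j ≤ 4 / 3 * (G.CF * (P.Klam * U) ^ 2) :=
      (hsub _ fun j => thermalBar_nonneg hCF P U β j).trans (thermalBar_sum_le hCF P U β hn)
    have h2 : ∑ j ∈ Ioc t n, legDressBarQ G P Q U j (legSliceCountT L β μ K j ![k', Qm - k', Qm - k, k]) ≤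
        20 * (2 * Q.CR * P.Klam ^ 3 * U ^ 2) :=
      ((hsub _ fun j => legDressBarQ_nonneg G hK0 hQ.2.1 U j _).trans
          (legDressBarQ_countT_sum_le L G hK0 hQ.2.1 U β μ K _ n)).trans (by nlinarith [hcr3])
    have h3 : ∑ j ∈ Ioc t n, (P.Klam * U) ^ 2 * (max (G.phGain j (klTorusNorm L (k - k'))) 0 + max (G.phGain j (klTorusNorm L (k + k' - Qm))) 0) ≤
        2 * (G.CF * (P.Klam * U) ^ 2) :=
      (hsub _ fun j => klbs9_X_nonneg G P U j _ _).trans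
        (klbs9_X_sum_le hG P U (n + 1) (torusSupNorm_nonneg _) (torusSupNorm_nonneg _))
    linarith
  · -- scale sums `m ≤ n`: the scale-0 term plus the shifted inductive sums
    intro L G P Q β U μ K n Qm k k' hG hP hQ hU hU1 hn
    have hCF : 0 ≤ G.CF := hG.2.2.2.2.2.2.2.2.2.2.2.2.2.1
    have hK0 : 0 ≤ P.Klam := zero_le_one.trans hP.1
    have hCR : 0 ≤ Q.CR := hQ.2.1
    have hcr3 := cr3_le hP.1 hCR hU1
    have hq30 : 0 ≤ Q.CR * P.Klam ^ 3 * U ^ 2 := by positivity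
    have heq : ∀ i ∈ range n, (if 1 ≤ i + 1 then thermalBar G P U β (i + 1) +
        legDressBarQ G P Q U (i + 1) (legSliceCountT L β μ K (i + 1) ![k', Qm - k', Qm - k, k]) +
        (P.Klam * U) ^ 2 * (max (G.phGain (i + 1) (klTorusNorm L (k - k'))) 0 + max (G.phGain (i + 1) (klTorusNorm L (k + k' - Qm))) 0)
        else legDressBarQ G P Q U 0 4) =
        thermalBar G P U β (i + 1) + legDressBarQ G P Q U (i + 1) (legSliceCountT L β μ K (i + 1) ![k', Qm - k', Qm - k, k]) +
        (P.Klam * U) ^ 2 * (max (G.phGain (i + 1) (klTorusNorm L (k - k'))) 0 + max (G.phGain (i + 1) (klTorusNorm L (k + k' - Qm))) 0) :=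
      fun i _ => by rw [if_pos (by omega)]
    rw [if_neg (by omega), sum_congr rfl heq, sum_add_distrib, sum_add_distrib]
    have h0 := legDressBarQ_le G hK0 hCR U 0 4
    have h0' : Q.CR * ((P.Klam * U) ^ 2 + (P.Klam * |U|) ^ 3) * ((4 : ℕ) : ℝ) ≤ 2 * Q.CR * P.Klam ^ 3 * U ^ 2 * 4 := by
      rw [Nat.cast_ofNat]; nlinarith [hcr3]
    have h1 : ∑ i ∈ range n, thermalBar G P U β (i + 1) ≤ 4 / 3 * (G.CF * (P.Klam * U) ^ 2) :=
      (sum_range_succ_shift_le (f := fun m => thermalBar G P U β m) (fun m => thermalBar_nonneg hCF P U β m) n).trans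
        (thermalBar_sum_le hCF P U β hn)
    have h2 : ∑ i ∈ range n, legDressBarQ G P Q U (i + 1) (legSliceCountT L β μ K (i + 1) ![k', Qm - k', Qm - k, k]) ≤
        20 * (2 * Q.CR * P.Klam ^ 3 * U ^ 2) :=
      ((sum_range_succ_shift_le (f := fun m => legDressBarQ G P Q U m (legSliceCountT L β μ K m ![k', Qm - k', Qm - k, k]))
          (fun m => legDressBarQ_nonneg G hK0 hQ.2.1 U m _) n).trans
          (legDressBarQ_countT_sum_le L G hK0 hQ.2.1 U β μ K _ n)).trans (by nlinarith [hcr3])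
    have h3 : ∑ i ∈ range n, (P.Klam * U) ^ 2 *
        (max (G.phGain (i + 1) (klTorusNorm L (k - k'))) 0 + max (G.phGain (i + 1) (klTorusNorm L (k + k' - Qm))) 0) ≤
        2 * (G.CF * (P.Klam * U) ^ 2) :=
      (sum_range_succ_shift_le
          (f := fun m => (P.Klam * U) ^ 2 * (max (G.phGain m (klTorusNorm L (k - k'))) 0 + max (G.phGain m (klTorusNorm L (k + k' - Qm))) 0))
          (fun m => klbs9_X_nonneg G P U m _ _) n).trans
        (klbs9_X_sum_le hG P U (n + 1) (torusSupNorm_nonneg _) (torusSupNorm_nonneg _))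
    linarith
  · -- the sign-defect allowance `2·klEdge` is in-class scale-summable (verbatim from p475114)
    intro L G P Q β U μ K t Qm hG hP hQ hU hU1 ht hQt
    have hbhi : 0 ≤ G.bhi := hG.2.2.1.trans hG.2.2.2.1
    have h1 : ∑ i ∈ range t, 2 * klEdge G (i + 1) (klTorusNorm L Qm) =
        2 * G.bhi * ∑ i ∈ range t, min 1 ((2 * (4 : ℝ) ^ 5) * klTorusNorm L Qm * (4 : ℝ) ^ (i + 1)) := by
      rw [mul_sum]
      refine sum_congr rfl fun i _ => ?_
      rw [klEdge_eq_pow, show 2 * klTorusNorm L Qm * (4 : ℝ) ^ (i + 1 + 5) = (2 * (4 : ℝ) ^ 5) * klTorusNorm L Qm * (4 : ℝ) ^ (i + 1) by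
        rw [pow_add]; ring]
      ring
    have h2 : ∑ i ∈ range t, min 1 ((2 * (4 : ℝ) ^ 5) * klTorusNorm L Qm * (4 : ℝ) ^ (i + 1)) ≤ 22 / 3 :=
      (sum_min_one_edge_le (s := 6) (torusSupNorm_nonneg _) (by norm_num) hQt).trans (by norm_num)
    rw [h1]
    refine (mul_le_mul_of_nonneg_left h2 (by positivity : (0 : ℝ) ≤ 2 * G.bhi)).trans ?_
    linarith
  · -- the engine slot yields `EngineBoundsAtW9S`: project the clauses child 1 reads ((E2-v9): (m), (neg), right inverse, bound)
    intro L M _ _ G P Q β U μ K n h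
    have h' : EngineBoundsAtW9S L M G P Q β U μ K n := he L M G P Q β U μ K n h
    refine ⟨fun hn0 Qm k hk k' hk' => ?_, fun hn1 Qm hQ => ?_, fun hn1 Qm k hk k' hk' => ?_, h'.2.2.2.2.2.2.1, h'.2.2.2.2.2.2.2⟩
    · rw [if_neg (by omega)]
      exact h'.2.2.1.1 hn0 Qm k hk k' hk'
    · obtain ⟨w, hwabs, hwneg, N, hN, hb⟩ := h'.2.2.1.2 hn1 Qm hQ
      refine ⟨w, hwabs, hwneg, N, hN, fun k hk k' hk' => (hb k hk k' hk').trans ?_⟩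
      rw [if_pos hn1]
      have hx := klbs9_X_le_X G P U n (klTorusNorm L (k - k')) (klTorusNorm L (k + k' - Qm))
      linarith
    · have hx := klbs9_X_nonneg G P U n (klTorusNorm L (k - k')) (klTorusNorm L (k + k' - Qm))
      refine (h'.2.2.2.1 hn1 Qm k hk k' hk').trans ?_
      rw [if_pos hn1]
      linarith

end Summit.HubbardSuperconductivity.HubbardSuperconductivity.Theorems.KLRegimeSplit

end
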